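import Literature.NumberTheory.GaloisRepresentations.LubinTateColemanCoordUnipotentTwo
import Literature.NumberTheory.GaloisRepresentations.LubinTateColemanLogDerivSurjModTwo
import HarnessLib

/-!
# `q = 2`, `π = 2u`: the expansions `[γ]_f ≡ X + X⁴ (mod π, X⁵)` and `ρ_γ ≡ 1 + Y² (mod π, Y³)` for `γ = 1 + π²w`, `w` a unit
# (the input for the rank-two triangular basis of the Coleman coordinate module; de Shalit I §1.2, §3.1, §3.4 Lemma (ii))

De Shalit, *Iwasawa theory of elliptic curves with complex multiplication* (1987), Ch. I §3.1: for `p = 2` the Iwasawa algebra of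
`𝒢 ≅ ℤ₂^×` is `ℤ₂[Δ]⟦S⟧` with `Γ' = 1 + 4ℤ₂ ∋ u ↦ 1 + S`; the Coleman coordinates `r_β ∈ 𝒪⟦Y⟧` (Theorem I.3.7 in the tree's series
currency) carry the action `r ↦ γ·ρ_γ·(r ∘ [γ]_f)` of `γ ∈ 𝒪_F^×` (`LubinTateColemanCoordGaloisTwo`).  To see that `𝒪⟦Y⟧` is free of rank
two over `𝒪⟦T⟧`, `T = σ_γ − 1` for a topological generator `γ` of `1 + 4ℤ₂` — i.e. `γ = 1 + π² w` with `w` a unit (`F = ℚ₂` in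
disguise: `|𝓀_F| = 2`, `π = 2u`) — one needs the first coefficients of `[γ]_f` and of the twist `ρ_γ` modulo `π`.  From the
defining relation `f ∘ [γ] = [γ] ∘ f`, `f = πX + X²` (Lubin–Tate 1965 (5)), comparing the coefficients of `X², X³, X⁴`:

* `ltSer_eq_two`, `subst_ltSer_eq_two` (`f∘H = πH + H²`), ★ `coeff_subst_ltSer_two` (**`[X^n](H∘f) = Σ_k [X^k]H · C(k, n−k) π^{2k−n}`**);
* ★★ `coeff_two_hom_mem`, `coeff_three_hom_mem`, `coeff_four_hom_sub_mem` — for `γ = 1 + π²w`: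
  **`[X²][γ], [X³][γ] ∈ (π)` and `[X⁴][γ] ≡ w (mod π)`**; hence, `w` a unit, ★★ `redSeries_hom_two`:
  **`[γ]_f ≡ X + X⁴·(1 + X·G) (mod π)`** (`X⁴ ∣ red[γ] − X`, `[X⁴] red[γ] = 1`);
* ★★ `coeff_redSeries_rho_two` — for the twist `ρ_γ = evenPartTwo (unitTwistSerTwo u⁻¹ γ)` defined by `(1 + tX)(ρ_γ ∘ f) = 1 + t[γ]`
  (`t = u⁻¹`, `π = 2u`): **`ρ_γ ≡ 1 + Y² (mod π, Y³)`** (reduce: `(1 + X)·ρ̄_γ(X²) = 1 + red[γ]`); helpers `redSeries_C`, `redSeries_X`,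
  `residue_of_unit_two`.

Everything PROVED (0 sorry, no named facts, no new definitions).  Sequel: `D(Y^k) = γρ_γ[γ]^k − Y^k ≡ Y^{k+2} (mod π, Y^{k+3})` and the
freeness of `𝒪⟦Y⟧` over `𝒪⟦T⟧` (`PowerSeriesTopNilpotentBasisFree`).

## References

* E. de Shalit, *Iwasawa theory of elliptic curves with complex multiplication* (1987), Ch. I §1.2, §3.1, §3.4 Lemma (ii). [deShalit1987]
* J. Lubin, J. Tate, *Formal complex multiplication in local fields*, Ann. of Math. 81 (1965), §1 (5). [LubinTate1965]
-/

noncomputable section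

open scoped PowerSeries.WithPiTopology

namespace Literature.NumberTheory.GaloisRepresentations

section HomExpansionTwo

open GaloisRepresentations.IsNonarchimedeanLocalField LubinTate ValuativeRel Finset

variable {F : Type} [Field F] [ValuativeRel F] [TopologicalSpace F] [IsNonarchimedeanLocalField F]

attribute [local instance] ltNormUniformSpace ltNormIsUniformAddGroup rk1 nF nE fintypeResidueField

variable {π : 𝒪[F]} (hπ : (valuation F).IsUniformizer (π : F)) (hq : residueFieldCard F = 2)

/-! ### `f = πX + X²` and the coefficients of `H ∘ f` -/

include hq in
/-- `f = πX + X²` at `q = 2`. [cite: deShalit1987, Ch. I §1.2] -/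
theorem ltSer_eq_two : ltSer F π = PowerSeries.C (LTCoeff.of F π) * PowerSeries.X + PowerSeries.X ^ 2 := by
  change ((ltPoly F π : Polynomial 𝒪[F]) : PowerSeries 𝒪[F]) = _
  rw [ltPoly, Polynomial.coe_add, Polynomial.coe_mul, Polynomial.coe_pow, Polynomial.coe_C, Polynomial.coe_X, hq]
  rfl

include hq in
/-- `f ∘ H = π·H + H²` (`H(0) = 0`). [cite: LubinTate1965, §1 (5)] -/
theorem subst_ltSer_eq_two {H : PowerSeries (LTCoeff F)} (hH : PowerSeries.constantCoeff H = 0) :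
    PowerSeries.subst H (ltSer F π) = PowerSeries.C (LTCoeff.of F π) * H + H ^ 2 := by
  have hs : PowerSeries.HasSubst H := PowerSeries.HasSubst.of_constantCoeff_zero' hH
  rw [ltSer_eq_two hq, ← PowerSeries.coe_substAlgHom hs, map_add, map_mul, map_pow, PowerSeries.coe_substAlgHom,
    PowerSeries.subst_X hs, PowerSeries.C_eq_algebraMap, ← PowerSeries.coe_substAlgHom hs, AlgHom.commutes]

include hq in
/-- ★ **`[X^n](H ∘ f) = Σ_{k ≤ n} [X^k]H · π^{2k−n} C(k, n−k)`** (`f = X(π + X)`, so `[X^n]f^k = C(k, n−k)π^{2k−n}`).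
[cite: LubinTate1965, §1 (5)] -/
theorem coeff_subst_ltSer_two (H : PowerSeries (LTCoeff F)) (n : ℕ) :
    PowerSeries.coeff n (PowerSeries.subst (ltSer F π) H) =
      ∑ k ∈ range (n + 1), PowerSeries.coeff k H * (LTCoeff.of F π ^ (k - (n - k)) * (k.choose (n - k) : LTCoeff F)) := by
  have hf : PowerSeries.HasSubst (ltSer F π) := PowerSeries.HasSubst.of_constantCoeff_zero' (isLTSeries_ltSer π).constantCoeff_eq_zero
  have hfk : ∀ k, ltSer F π ^ k = PowerSeries.X ^ k * (PowerSeries.C (LTCoeff.of F π) + PowerSeries.X) ^ k := fun k => by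
    rw [ltSer_eq_two hq, ← mul_pow]; ring
  have hpoly : ∀ k m, PowerSeries.coeff m ((PowerSeries.C (LTCoeff.of F π) + PowerSeries.X) ^ k) =
      LTCoeff.of F π ^ (k - m) * (k.choose m : LTCoeff F) := fun k m => by
    rw [show (PowerSeries.C (LTCoeff.of F π) + PowerSeries.X : PowerSeries (LTCoeff F)) ^ k =
        (((Polynomial.X + Polynomial.C (LTCoeff.of F π)) ^ k : Polynomial (LTCoeff F)) : PowerSeries (LTCoeff F)) by
      rw [Polynomial.coe_pow, Polynomial.coe_add, Polynomial.coe_X, Polynomial.coe_C, add_comm], Polynomial.coeff_coe,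
      Polynomial.coeff_X_add_C_pow]
  have hcoeff : ∀ k, PowerSeries.coeff n (ltSer F π ^ k) = if k ≤ n then LTCoeff.of F π ^ (k - (n - k)) * (k.choose (n - k) : LTCoeff F) else 0 :=
    fun k => by rw [hfk, PowerSeries.coeff_X_pow_mul']; split_ifs with h <;> [rw [hpoly]; rfl]
  rw [PowerSeries.coeff_subst' hf, finsum_eq_sum_of_support_subset _ (s := range (n + 1)) ?_]
  · refine sum_congr rfl fun k hk => ?_
    rw [smul_eq_mul, hcoeff, if_pos (Nat.lt_succ_iff.mp (mem_range.mp hk))]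
  · intro k hk
    rw [Function.mem_support] at hk
    rw [coe_range, Set.mem_Iio]
    by_contra hkn
    exact hk (by rw [hcoeff, if_neg (by omega), smul_zero])

/-! ### The coefficients of `[γ]_f` for `γ = 1 + π²w` -/

include hq in
/-- The three coefficient identities `[X^n](πH + H²) = [X^n](H ∘ f)`, `n = 2, 3, 4`, for `H = [γ]_f` (`H(0) = 0`, `[X]H = γ`), solved
successively: with `2 = πt` and `γ = 1 + π²w`, `[X²]H = π b₂` with `b₂ ≡ −w`, `[X³]H = π b₃`, `[X⁴]H ≡ b₂ (mod π)`.
[cite: LubinTate1965, §1 (5)] -/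
private theorem hom_coeff_two_aux {t : LTCoeff F} (ht : (2 : LTCoeff F) = LTCoeff.of F π * t) (γ : 𝒪[F]ˣ) {w : 𝒪[F]}
    (hγ : (γ : 𝒪[F]) = 1 + π ^ 2 * w) :
    PowerSeries.coeff 2 (hom (isLTRing_LTCoeff hπ) (isLTSeries_LTCoeff π) (isLTSeries_LTCoeff π) (LTCoeff.of F (γ : 𝒪[F]))) ∈
        Ideal.span {LTCoeff.of F π} ∧
      PowerSeries.coeff 3 (hom (isLTRing_LTCoeff hπ) (isLTSeries_LTCoeff π) (isLTSeries_LTCoeff π) (LTCoeff.of F (γ : 𝒪[F]))) ∈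
        Ideal.span {LTCoeff.of F π} ∧
      PowerSeries.coeff 4 (hom (isLTRing_LTCoeff hπ) (isLTSeries_LTCoeff π) (isLTSeries_LTCoeff π) (LTCoeff.of F (γ : 𝒪[F]))) -
        LTCoeff.of F w ∈ Ideal.span {LTCoeff.of F π} := by
  haveI : IsDomain (LTCoeff F) := inferInstanceAs (IsDomain 𝒪[F])
  obtain ⟨H, hH⟩ : ∃ H : PowerSeries (LTCoeff F),
      H = hom (isLTRing_LTCoeff hπ) (isLTSeries_LTCoeff π) (isLTSeries_LTCoeff π) (LTCoeff.of F (γ : 𝒪[F])) := ⟨_, rfl⟩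
  rw [← hH]
  have hπ0 : LTCoeff.of F π ≠ 0 := fun h =>
    one_ne_zero ((isLTRing_LTCoeff hπ).eq_zero_of_mul_eq_zero 1 (by rw [h, zero_mul]))
  -- abbreviations
  set p : LTCoeff F := LTCoeff.of F π with hp
  set g : LTCoeff F := LTCoeff.of F (γ : 𝒪[F]) with hg
  set w' : LTCoeff F := LTCoeff.of F w with hw'
  have hγ' : g = 1 + p ^ 2 * w' := by rw [hg, hγ, map_add, map_one, map_mul, map_pow]
  have h0 : PowerSeries.coeff 0 H = 0 := by rw [PowerSeries.coeff_zero_eq_constantCoeff, hH]; exact constantCoeff_hom _ _ _ _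
  have h1 : PowerSeries.coeff 1 H = g := by rw [hH, coeff_one_hom]
  -- the relation `πH + H² = H ∘ f`
  have hrel : PowerSeries.C p * H + H ^ 2 = PowerSeries.subst (ltSer F π) H := by
    rw [← subst_ltSer_eq_two hq (by rw [← PowerSeries.coeff_zero_eq_constantCoeff, h0]), hH]
    exact subst_hom _ _ _ _
  have hL : ∀ n, PowerSeries.coeff n (PowerSeries.C p * H + H ^ 2) =
      p * PowerSeries.coeff n H + ∑ i ∈ range (n + 1), PowerSeries.coeff i H * PowerSeries.coeff (n - i) H := fun n => by
    rw [map_add, PowerSeries.coeff_C_mul, pow_two, PowerSeries.coeff_mul, Nat.sum_antidiagonal_eq_sum_range_succ_mk]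
  have hE : ∀ n, p * PowerSeries.coeff n H + ∑ i ∈ range (n + 1), PowerSeries.coeff i H * PowerSeries.coeff (n - i) H =
      ∑ k ∈ range (n + 1), PowerSeries.coeff k H * (p ^ (k - (n - k)) * (k.choose (n - k) : LTCoeff F)) := fun n => by
    rw [← hL, hrel, coeff_subst_ltSer_two hq]
  have E2 := hE 2
  have E3 := hE 3
  have E4 := hE 4
  norm_num [sum_range_succ, h0, h1, Nat.choose] at E2 E3 E4
  set a₂ := PowerSeries.coeff 2 H with ha₂
  set a₃ := PowerSeries.coeff 3 H with ha₃
  set a₄ := PowerSeries.coeff 4 H with ha₄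
  have E2' : p * a₂ + g * g = g + a₂ * p ^ 2 := by linear_combination E2
  have E3' : p * a₃ + 2 * g * a₂ = 2 * p * a₂ + p ^ 3 * a₃ := by linear_combination E3
  have E4' : p * a₄ + 2 * g * a₃ + a₂ ^ 2 = a₂ + 3 * p ^ 2 * a₃ + p ^ 4 * a₄ := by linear_combination E4
  -- step 2: a₂ = p b₂ with b₂ = a₂ − g w' ≡ −w'
  have hb₂ : a₂ = p * (a₂ - g * w') := by
    refine mul_left_cancel₀ hπ0 ?_
    linear_combination E2' - g * hγ'
  set b₂ := a₂ - g * w' with hb₂def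
  have hb₂w : b₂ + w' = p * (b₂ - p * w' ^ 2) := by
    linear_combination hb₂ - w' * hγ' + (1 - p) * hb₂def
  -- step 3: a₃ = p b₃
  have hb₃ : a₃ = p * (p * a₃ + t * b₂ * (p - g)) := by
    refine mul_left_cancel₀ hπ0 ?_
    linear_combination E3' + (a₂ * (p - g)) * ht + (p * t * (p - g)) * hb₂
  set b₃ := p * a₃ + t * b₂ * (p - g) with hb₃def
  -- step 4: a₄ ≡ b₂ (mod p)
  have hb₄ : a₄ = b₂ + p * (p ^ 2 * a₄ + 3 * p * b₃ - t * g * b₃ - b₂ ^ 2) := by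
    refine mul_left_cancel₀ hπ0 ?_
    linear_combination E4' - (g * a₃) * ht + (3 * p ^ 2 - p * t * g) * hb₃ + (1 - a₂ - p * b₂) * hb₂
  refine ⟨?_, ?_, ?_⟩
  · exact Ideal.mem_span_singleton'.mpr ⟨b₂, by rw [mul_comm]; exact hb₂.symm⟩
  · exact Ideal.mem_span_singleton'.mpr ⟨b₃, by rw [mul_comm]; exact hb₃.symm⟩
  · -- a₄ − w' = (a₄ − b₂) + (b₂ + w') − 2w', and 2 = p t
    have e : a₄ - w' = p * (p ^ 2 * a₄ + 3 * p * b₃ - t * g * b₃ - b₂ ^ 2) + p * (b₂ - p * w' ^ 2) - p * (t * w') := by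
      linear_combination hb₄ + hb₂w - w' * ht
    rw [e]
    exact sub_mem (add_mem (Ideal.mem_span_singleton'.mpr ⟨_, mul_comm _ _⟩) (Ideal.mem_span_singleton'.mpr ⟨_, mul_comm _ _⟩))
      (Ideal.mem_span_singleton'.mpr ⟨_, mul_comm _ _⟩)

include hq in
/-- ★★ **`[X²][γ]_f ∈ (π)`** for `γ = 1 + π²w` (`[X²][γ] = γ(1−γ)/(π(1−π))`). [cite: LubinTate1965, §1 (5)] -/
theorem coeff_two_hom_mem {t : LTCoeff F} (ht : (2 : LTCoeff F) = LTCoeff.of F π * t) (γ : 𝒪[F]ˣ) {w : 𝒪[F]}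
    (hγ : (γ : 𝒪[F]) = 1 + π ^ 2 * w) :
    PowerSeries.coeff 2 (hom (isLTRing_LTCoeff hπ) (isLTSeries_LTCoeff π) (isLTSeries_LTCoeff π) (LTCoeff.of F (γ : 𝒪[F]))) ∈
      Ideal.span {LTCoeff.of F π} :=
  (hom_coeff_two_aux hπ hq ht γ hγ).1

include hq in
/-- ★★ **`[X³][γ]_f ∈ (π)`** for `γ = 1 + π²w`. [cite: LubinTate1965, §1 (5)] -/
theorem coeff_three_hom_mem {t : LTCoeff F} (ht : (2 : LTCoeff F) = LTCoeff.of F π * t) (γ : 𝒪[F]ˣ) {w : 𝒪[F]}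
    (hγ : (γ : 𝒪[F]) = 1 + π ^ 2 * w) :
    PowerSeries.coeff 3 (hom (isLTRing_LTCoeff hπ) (isLTSeries_LTCoeff π) (isLTSeries_LTCoeff π) (LTCoeff.of F (γ : 𝒪[F]))) ∈
      Ideal.span {LTCoeff.of F π} :=
  (hom_coeff_two_aux hπ hq ht γ hγ).2.1

include hq in
/-- ★★ **`[X⁴][γ]_f ≡ w (mod π)`** for `γ = 1 + π²w`. [cite: LubinTate1965, §1 (5)] -/
theorem coeff_four_hom_sub_mem {t : LTCoeff F} (ht : (2 : LTCoeff F) = LTCoeff.of F π * t) (γ : 𝒪[F]ˣ) {w : 𝒪[F]}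
    (hγ : (γ : 𝒪[F]) = 1 + π ^ 2 * w) :
    PowerSeries.coeff 4 (hom (isLTRing_LTCoeff hπ) (isLTSeries_LTCoeff π) (isLTSeries_LTCoeff π) (LTCoeff.of F (γ : 𝒪[F]))) -
      LTCoeff.of F w ∈ Ideal.span {LTCoeff.of F π} :=
  (hom_coeff_two_aux hπ hq ht γ hγ).2.2

/-! ### Reduction modulo `π`: `[γ]_f ≡ X + X⁴(1 + X·G)` -/

/-- `red (C a) = C ā`. [cite: deShalit1987, Ch. I §3.12] -/
theorem redSeries_C (a : LTCoeff F) :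
    redSeries F (PowerSeries.C a) = PowerSeries.C (IsLocalRing.residue 𝒪[F] ((LTCoeff.of F).symm a)) := by
  rw [redSeries, PowerSeries.map_C]; rfl

/-- `red X = X`. [cite: deShalit1987, Ch. I §3.12] -/
theorem redSeries_X : redSeries F (PowerSeries.X : PowerSeries (LTCoeff F)) = PowerSeries.X := by
  rw [redSeries, PowerSeries.map_X]

include hπ hq in
/-- The residue of a unit is `1` (`|𝓀_F| = 2`). [cite: deShalit1987, Ch. I §3.1 (p = 2)] -/
theorem residue_of_unit_two (v : 𝒪[F]ˣ) : IsLocalRing.residue 𝒪[F] ((LTCoeff.of F).symm (LTCoeff.of F (v : 𝒪[F]))) = 1 := by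
  have h := sub_one_mem_span_pi_of_isUnit_two hπ hq v
  rw [← residue_eq_zero_iff_mem hπ, map_sub, map_sub, map_one, map_one, sub_eq_zero] at h
  exact h

include hq in
/-- ★★ **`[γ]_f ≡ X + X⁴ + (deg ≥ 5) (mod π)`** for `γ = 1 + π²w` with `w` a UNIT: the first five coefficients of `red[γ]_f` are
`0, 1, 0, 0, 1`. [cite: LubinTate1965, §1 (5)] -/
theorem coeff_redSeries_hom_two {t : LTCoeff F} (ht : (2 : LTCoeff F) = LTCoeff.of F π * t) (γ w : 𝒪[F]ˣ)
    (hγ : (γ : 𝒪[F]) = 1 + π ^ 2 * w) :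
    PowerSeries.coeff 0 (redSeries F (hom (isLTRing_LTCoeff hπ) (isLTSeries_LTCoeff π) (isLTSeries_LTCoeff π) (LTCoeff.of F (γ : 𝒪[F])))) = 0 ∧
    PowerSeries.coeff 1 (redSeries F (hom (isLTRing_LTCoeff hπ) (isLTSeries_LTCoeff π) (isLTSeries_LTCoeff π) (LTCoeff.of F (γ : 𝒪[F])))) = 1 ∧
    PowerSeries.coeff 2 (redSeries F (hom (isLTRing_LTCoeff hπ) (isLTSeries_LTCoeff π) (isLTSeries_LTCoeff π) (LTCoeff.of F (γ : 𝒪[F])))) = 0 ∧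
    PowerSeries.coeff 3 (redSeries F (hom (isLTRing_LTCoeff hπ) (isLTSeries_LTCoeff π) (isLTSeries_LTCoeff π) (LTCoeff.of F (γ : 𝒪[F])))) = 0 ∧
    PowerSeries.coeff 4 (redSeries F (hom (isLTRing_LTCoeff hπ) (isLTSeries_LTCoeff π) (isLTSeries_LTCoeff π) (LTCoeff.of F (γ : 𝒪[F])))) = 1 := by
  refine ⟨?_, ?_, ?_, ?_, ?_⟩
  · rw [coeff_redSeries, PowerSeries.coeff_zero_eq_constantCoeff, constantCoeff_hom, map_zero, map_zero]
  · rw [coeff_redSeries, coeff_one_hom]; exact residue_of_unit_two hπ hq γ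
  · rw [coeff_redSeries]; exact (residue_eq_zero_iff_mem hπ _).mpr (coeff_two_hom_mem hπ hq ht γ hγ)
  · rw [coeff_redSeries]; exact (residue_eq_zero_iff_mem hπ _).mpr (coeff_three_hom_mem hπ hq ht γ hγ)
  · rw [coeff_redSeries]
    have h := coeff_four_hom_sub_mem hπ hq ht γ hγ
    rw [← residue_eq_zero_iff_mem hπ, map_sub, map_sub, residue_of_unit_two hπ hq w, sub_eq_zero] at h
    exact h

include hq in
/-- ★★ **`red[γ]_f = X + X⁴·(1 + X·G)`** for some `G ∈ 𝓀_F⟦X⟧` (`γ = 1 + π²w`, `w` a unit). [cite: LubinTate1965, §1 (5)] -/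
theorem redSeries_hom_two {t : LTCoeff F} (ht : (2 : LTCoeff F) = LTCoeff.of F π * t) (γ w : 𝒪[F]ˣ) (hγ : (γ : 𝒪[F]) = 1 + π ^ 2 * w) :
    ∃ G : PowerSeries 𝓀[F], redSeries F (hom (isLTRing_LTCoeff hπ) (isLTSeries_LTCoeff π) (isLTSeries_LTCoeff π) (LTCoeff.of F (γ : 𝒪[F]))) =
      PowerSeries.X + PowerSeries.X ^ 4 * (1 + PowerSeries.X * G) := by
  obtain ⟨c0, c1, c2, c3, c4⟩ := coeff_redSeries_hom_two hπ hq ht γ w hγ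
  set R := redSeries F (hom (isLTRing_LTCoeff hπ) (isLTSeries_LTCoeff π) (isLTSeries_LTCoeff π) (LTCoeff.of F (γ : 𝒪[F]))) with hR
  have hdvd : (PowerSeries.X : PowerSeries 𝓀[F]) ^ 5 ∣ R - PowerSeries.X - PowerSeries.X ^ 4 := by
    rw [PowerSeries.X_pow_dvd_iff]
    intro m hm
    rw [map_sub, map_sub, PowerSeries.coeff_X_pow, PowerSeries.coeff_X]
    interval_cases m
    · rw [c0]; simp
    · rw [c1]; simp
    · rw [c2]; simp
    · rw [c3]; simp
    · rw [c4]; simp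
  obtain ⟨G, hG⟩ := hdvd
  exact ⟨G, by linear_combination hG⟩

/-! ### The twist `ρ_γ ≡ 1 + Y² (mod π, Y³)` -/

include hq in
/-- ★★ **`ρ_γ ≡ 1 + Y² (mod π, Y³)`**: the first three coefficients of `red ρ_γ` are `1, 0, 1`, for `ρ_γ = evenPartTwo (unitTwistSerTwo t γ)`
(`(1 + tX)(ρ_γ ∘ f) = 1 + t[γ]_f`, `2 = πt`, `t` a unit), `γ = 1 + π²w`, `w` a unit: reducing, `(1 + X)·ρ̄_γ(X²) = 1 + red[γ]_f =
(1 + X)(1 + X⁴) + O(X⁶)`. [cite: deShalit1987, Ch. I §3.4 Lemma (ii)] -/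
theorem coeff_redSeries_rho_two (u : (LTCoeff F)ˣ) (hu : LTCoeff.of F π = residueFieldCard F * u) (γ w : 𝒪[F]ˣ)
    (hγ : (γ : 𝒪[F]) = 1 + π ^ 2 * w) :
    PowerSeries.coeff 0 (redSeries F (evenPartTwo hπ hq (unitTwistSerTwo hπ (↑u⁻¹ : LTCoeff F) γ))) = 1 ∧
    PowerSeries.coeff 1 (redSeries F (evenPartTwo hπ hq (unitTwistSerTwo hπ (↑u⁻¹ : LTCoeff F) γ))) = 0 ∧
    PowerSeries.coeff 2 (redSeries F (evenPartTwo hπ hq (unitTwistSerTwo hπ (↑u⁻¹ : LTCoeff F) γ))) = 1 := by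
  have ht := two_eq_of_mul_inv hq u hu
  obtain ⟨c0, c1, c2, c3, c4⟩ := coeff_redSeries_hom_two hπ hq ht γ w hγ
  -- reduce `(1 + tX)(ρ ∘ f) = 1 + tH`
  have hrel := one_add_mul_subst_evenPartTwo_unitTwistSerTwo hπ hq ht γ
  set ρ := evenPartTwo hπ hq (unitTwistSerTwo hπ (↑u⁻¹ : LTCoeff F) γ) with hρ
  set Hb := redSeries F (hom (isLTRing_LTCoeff hπ) (isLTSeries_LTCoeff π) (isLTSeries_LTCoeff π) (LTCoeff.of F (γ : 𝒪[F]))) with hHb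
  have htu : IsLocalRing.residue 𝒪[F] ((LTCoeff.of F).symm (↑u⁻¹ : LTCoeff F)) = 1 := by
    have : (↑u⁻¹ : LTCoeff F) = LTCoeff.of F (((LTCoeff.of F).symm (↑u⁻¹ : LTCoeff F) : 𝒪[F])) := by simp
    obtain ⟨v, hv⟩ : ∃ v : 𝒪[F]ˣ, (v : 𝒪[F]) = (LTCoeff.of F).symm (↑u⁻¹ : LTCoeff F) :=
      ⟨Units.map (LTCoeff.of F).symm.toRingHom.toMonoidHom u⁻¹, rfl⟩
    have h := residue_of_unit_two hπ hq v
    rwa [hv, RingEquiv.apply_symm_apply] at h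
  have hexp : redSeries F (PowerSeries.subst (ltSer F π) ρ) = PowerSeries.expand 2 two_ne_zero (redSeries F ρ) := by
    rw [← redSeries_expand]
    refine (redSeries_eq_iff hπ _ _).mpr ?_
    have hgen : ∀ (q : ℕ) (hq0 : q ≠ 0), q = 2 → IsLTSeries (LTCoeff.of F π) q (ltSer F π) →
        PowerSeries.subst (ltSer F π) ρ - PowerSeries.expand 2 two_ne_zero ρ ∈ coeffIdeal (Ideal.span {LTCoeff.of F π}) := by
      rintro q hq0 rfl hf
      exact subst_sub_expand_mem_coeffIdeal hf two_ne_zero ρ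
    exact hgen (residueFieldCard F) (by rw [hq]; exact two_ne_zero) hq (isLTSeries_ltSer (F := F) π)
  have key : (1 + PowerSeries.X) * PowerSeries.expand 2 two_ne_zero (redSeries F ρ) = 1 + Hb := by
    have h := congrArg (redSeries F) hrel
    simp only [map_mul, map_add, map_one, redSeries_C, redSeries_X, htu, one_mul, hexp] at h
    exact h
  -- compare coefficients 0, 2, 4
  have hc : ∀ n, PowerSeries.coeff n ((1 + PowerSeries.X) * PowerSeries.expand 2 two_ne_zero (redSeries F ρ)) =
      PowerSeries.coeff n (PowerSeries.expand 2 two_ne_zero (redSeries F ρ)) +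
        (if n = 0 then 0 else PowerSeries.coeff (n - 1) (PowerSeries.expand 2 two_ne_zero (redSeries F ρ))) := fun n => by
    rw [add_mul, one_mul, map_add]
    congr 1
    rcases Nat.eq_zero_or_pos n with rfl | hn
    · rw [if_pos rfl, PowerSeries.coeff_zero_eq_constantCoeff, map_mul, PowerSeries.constantCoeff_X, zero_mul]
    · obtain ⟨m, rfl⟩ := Nat.exists_eq_add_of_le' hn
      rw [if_neg (Nat.succ_ne_zero m), PowerSeries.coeff_succ_X_mul, Nat.add_sub_cancel]
  have e0 := congrArg (PowerSeries.coeff 0) key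
  have e2 := congrArg (PowerSeries.coeff 2) key
  have e4 := congrArg (PowerSeries.coeff 4) key
  rw [hc, PowerSeries.coeff_expand, if_pos (dvd_zero 2), Nat.zero_div, if_pos rfl, add_zero, map_add, PowerSeries.coeff_one, if_pos rfl,
    c0, add_zero] at e0
  rw [hc, PowerSeries.coeff_expand, if_pos (dvd_refl 2), Nat.div_self two_pos, if_neg two_ne_zero, show (2 : ℕ) - 1 = 1 from rfl,
    PowerSeries.coeff_expand, if_neg (by norm_num), add_zero, map_add, PowerSeries.coeff_one, if_neg two_ne_zero, zero_add, c2] at e2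
  rw [hc, PowerSeries.coeff_expand, if_pos (by norm_num : (2 : ℕ) ∣ 4), show (4 : ℕ) / 2 = 2 from rfl, if_neg (by norm_num),
    show (4 : ℕ) - 1 = 3 from rfl, PowerSeries.coeff_expand, if_neg (by norm_num), add_zero, map_add, PowerSeries.coeff_one,
    if_neg (by norm_num), zero_add, c4] at e4
  exact ⟨e0, e2, e4⟩

end HomExpansionTwo

end Literature.NumberTheory.GaloisRepresentations
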